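import Mathlib
import Summits.ValiantsHypothesis.ValiantsHypothesis.Theorems.RigidityForcesSymmetryRankRigidMinimalReprLaplaceFiveStarSquarefreeDivisible
import Summits.ValiantsHypothesis.ValiantsHypothesis.Theorems.RigidityForcesSymmetryRankRigidMinimalReprLaplaceFiveStarLemmaKEndgame

/-!
# ValiantsHypothesis / RigidityForcesSymmetry — crux `LaplaceOptimalFive` (stmt-ValiantsHypothesis-24813), crux idea
`young-shadow` (K1) on the star: **(L1) RESTRICTION RANK — RELATIONS AMONG THE OFF-DIAGONAL ENTRIES OF `Hess m + E`**
(memo `NOTE-p4g15-24813-K1-star.md` §10: `rank N ≥ 10 − dim D_ℓ`, `dim D_ℓ = 0, 0, 1` for `|supp λ| = 5, 4, 3`)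

`m = X₀⋯X₄`; the off-diagonal entries of `Hess m` are the squarefree cubic monomials `μ_{ab} = x^{{a,b}ᶜ}` (written
`monomial (𝟙_{{a,b}ᶜ}) 1` via `Finsupp.equivFunOnFinite`).  For ANY matrix `E` of polynomials whose off-diagonal entries are divisible
by `L = Σ λ_z X_z` (the T1 slack: ✓ `t1_slack_dvd`), a relation `Σ_{a≠b} c_{ab}(μ_{ab} + E_{ab}) = 0` makes the «off-diagonal sum»
`F = Σ_{a≠b} c_{ab} μ_{ab}` a squarefree cubic form divisible by `L` (`linForm_dvd_offDiagSum`), whose coefficients are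
`coeff_{𝟙_{{a,b}ᶜ}} F = c_{ab} + c_{ba}` (`coeff_offDiagSum_compl`).  Hence:

* `offDiag_entries_independent` — `|supp λ| ≥ 4`: every relation is trivial (`c_{ab} + c_{ba} = 0`): row rank `≥ 10`;
* `offDiag_relations_of_support_three` — `supp λ = {j,k}ᶜ`: every relation is a multiple of ONE explicit vector
  (`c_{ab} + c_{ba} = g · Σ_{i∉{a,b}} λ_i` for `{a,b} ⊂ supp λ`, `0` otherwise): row rank `≥ 9`.

(The cases `|supp λ| ≤ 2`, which need the explicit slack ✓ `t1_slack_entry`, and the T2 bound are NOT here.)  No definitions,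
no `sorry`.  Honest framing: (L1) bricks, close nothing; K1-on-the-star PAPER PASS, not kernel; `LaplaceOptimalFive` OPEN · CONTESTED
72/120; `VP ≠ VNP` NOT proved.
-/

set_option linter.dupNamespace false

namespace Summit.ValiantsHypothesis.ValiantsHypothesis.Theorems.RigidityForcesSymmetryRankRigidMinimalRepr

namespace LaplaceFiveStar

open Finset MvPolynomial

/-- The exponent `𝟙_{{a,b}ᶜ}` evaluated. [folklore] -/
theorem compl_exponent_apply (a b c : Fin 5) :
    (Finsupp.equivFunOnFinite.symm (fun z : Fin 5 => if z = a ∨ z = b then (0 : ℕ) else 1)) c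
      = if c = a ∨ c = b then 0 else 1 := by
  simp

/-- `𝟙_{{a,b}ᶜ}` has degree `3` for `a ≠ b`. [folklore] -/
theorem compl_exponent_degree (a b : Fin 5) (hab : a ≠ b) :
    (Finsupp.equivFunOnFinite.symm (fun z : Fin 5 => if z = a ∨ z = b then (0 : ℕ) else 1)).degree = 3 := by
  classical
  rw [Finsupp.degree_eq_sum]
  simp only [compl_exponent_apply]
  rw [Finset.sum_ite, Finset.sum_const_zero, zero_add, Finset.sum_const, smul_eq_mul, mul_one]
  have hf : (Finset.univ.filter fun z : Fin 5 => ¬(z = a ∨ z = b)) = (Finset.univ.erase a).erase b := by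
    ext z
    simp only [Finset.mem_filter, Finset.mem_univ, true_and, Finset.mem_erase, not_or]
    tauto
  rw [hf, Finset.card_erase_of_mem (by simp [Ne.symm hab]), Finset.card_erase_of_mem (Finset.mem_univ _)]
  simp

/-- Two complement exponents agree iff the pairs agree. [folklore] -/
theorem compl_exponent_eq_iff (a b a' b' : Fin 5) (hab : a ≠ b) (hab' : a' ≠ b') :
    (Finsupp.equivFunOnFinite.symm (fun z : Fin 5 => if z = a' ∨ z = b' then (0 : ℕ) else 1)
        = Finsupp.equivFunOnFinite.symm (fun z : Fin 5 => if z = a ∨ z = b then (0 : ℕ) else 1)) ↔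
      ((a' = a ∧ b' = b) ∨ (a' = b ∧ b' = a)) := by
  constructor
  · intro h
    have hz : ∀ z : Fin 5, (z = a' ∨ z = b') ↔ (z = a ∨ z = b) := by
      intro z
      have e := congr_arg (fun f : (Fin 5) →₀ ℕ => f z) h
      simp only [compl_exponent_apply] at e
      by_cases h1 : z = a' ∨ z = b'
      · by_cases h2 : z = a ∨ z = b
        · exact ⟨fun _ => h2, fun _ => h1⟩
        · rw [if_pos h1, if_neg h2] at e
          exact absurd e (by norm_num)
      · by_cases h2 : z = a ∨ z = b
        · rw [if_neg h1, if_pos h2] at e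
          exact absurd e (by norm_num)
        · exact ⟨fun h' => absurd h' h1, fun h' => absurd h' h2⟩
    have ha' := (hz a').mp (Or.inl rfl)
    have hb' := (hz b').mp (Or.inr rfl)
    rcases ha' with h1 | h1
    · rcases hb' with h2 | h2
      · exact absurd (h1.trans h2.symm) hab'
      · exact Or.inl ⟨h1, h2⟩
    · rcases hb' with h2 | h2
      · exact Or.inr ⟨h1, h2⟩
      · exact absurd (h1.trans h2.symm) hab'
  · rintro (⟨rfl, rfl⟩ | ⟨rfl, rfl⟩)
    · rfl
    · ext z
      simp only [compl_exponent_apply]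
      congr 1
      exact propext or_comm

/-- The off-diagonal sum `F = Σ_{a≠b} c_{ab} x^{{a,b}ᶜ}` is a cubic form. [folklore] -/
theorem offDiagSum_isHomogeneous (c : Fin 5 → Fin 5 → ℂ) (F : MvPolynomial (Fin 5) ℂ)
    (hF : F = ∑ a : Fin 5, ∑ b : Fin 5, (if a = b then 0 else
      C (c a b) * monomial (Finsupp.equivFunOnFinite.symm (fun z : Fin 5 => if z = a ∨ z = b then (0 : ℕ) else 1)) 1)) :
    F.IsHomogeneous 3 := by
  rw [hF]
  refine IsHomogeneous.sum _ _ _ fun a' _ => IsHomogeneous.sum _ _ _ fun b' _ => ?_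
  split_ifs with h
  · exact isHomogeneous_zero _ _ _
  · have h3 := (isHomogeneous_C (Fin 5) (c a' b')).mul
      (isHomogeneous_monomial (σ := Fin 5) (1 : ℂ) (compl_exponent_degree a' b' h))
    simpa using h3

/-- Coefficients of one summand of the off-diagonal sum. [folklore] -/
theorem coeff_offDiag_summand (c : Fin 5 → Fin 5 → ℂ) (m : Fin 5 →₀ ℕ) (a' b' : Fin 5) :
    coeff m (if a' = b' then (0 : MvPolynomial (Fin 5) ℂ) else
      C (c a' b') * monomial (Finsupp.equivFunOnFinite.symm (fun z : Fin 5 => if z = a' ∨ z = b' then (0 : ℕ) else 1)) 1)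
      = if a' = b' then 0 else c a' b' *
        (if Finsupp.equivFunOnFinite.symm (fun z : Fin 5 => if z = a' ∨ z = b' then (0 : ℕ) else 1) = m then 1 else 0) := by
  classical
  by_cases h : a' = b'
  · rw [if_pos h, if_pos h, coeff_zero]
  · rw [if_neg h, if_neg h, coeff_C_mul, coeff_monomial]

/-- The off-diagonal sum has no `X_i³`. [folklore] -/
theorem coeff_offDiagSum_cube (c : Fin 5 → Fin 5 → ℂ) (F : MvPolynomial (Fin 5) ℂ)
    (hF : F = ∑ a : Fin 5, ∑ b : Fin 5, (if a = b then 0 else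
      C (c a b) * monomial (Finsupp.equivFunOnFinite.symm (fun z : Fin 5 => if z = a ∨ z = b then (0 : ℕ) else 1)) 1))
    (i : Fin 5) : coeff (Finsupp.single i 3) F = 0 := by
  classical
  rw [hF, coeff_sum]
  refine Finset.sum_eq_zero fun a' _ => ?_
  rw [coeff_sum]
  refine Finset.sum_eq_zero fun b' _ => ?_
  rw [coeff_offDiag_summand]
  split_ifs with h1 h2
  · rfl
  · exfalso
    have hz := congr_arg (fun f : (Fin 5) →₀ ℕ => f i) h2
    simp only [compl_exponent_apply, Finsupp.single_eq_same] at hz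
    split_ifs at hz; omega
  · ring

/-- The off-diagonal sum has no `X_i² X_j`. [folklore] -/
theorem coeff_offDiagSum_sq (c : Fin 5 → Fin 5 → ℂ) (F : MvPolynomial (Fin 5) ℂ)
    (hF : F = ∑ a : Fin 5, ∑ b : Fin 5, (if a = b then 0 else
      C (c a b) * monomial (Finsupp.equivFunOnFinite.symm (fun z : Fin 5 => if z = a ∨ z = b then (0 : ℕ) else 1)) 1))
    (i j : Fin 5) : coeff (Finsupp.single i 2 + Finsupp.single j 1) F = 0 := by
  classical
  rw [hF, coeff_sum]
  refine Finset.sum_eq_zero fun a' _ => ?_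
  rw [coeff_sum]
  refine Finset.sum_eq_zero fun b' _ => ?_
  rw [coeff_offDiag_summand]
  split_ifs with h1 h2
  · rfl
  · exfalso
    have hz := congr_arg (fun f : (Fin 5) →₀ ℕ => f i) h2
    simp only [compl_exponent_apply, Finsupp.add_apply, Finsupp.single_eq_same, Finsupp.single_apply] at hz
    split_ifs at hz <;> omega
  · ring

/-- **Coefficients of the off-diagonal sum**: `coeff_{𝟙_{{a,b}ᶜ}} F = c_{ab} + c_{ba}` (`a ≠ b`). [folklore] -/
theorem coeff_offDiagSum_compl (c : Fin 5 → Fin 5 → ℂ) (F : MvPolynomial (Fin 5) ℂ)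
    (hF : F = ∑ a : Fin 5, ∑ b : Fin 5, (if a = b then 0 else
      C (c a b) * monomial (Finsupp.equivFunOnFinite.symm (fun z : Fin 5 => if z = a ∨ z = b then (0 : ℕ) else 1)) 1))
    (a b : Fin 5) (hab : a ≠ b) :
    coeff (Finsupp.equivFunOnFinite.symm (fun z : Fin 5 => if z = a ∨ z = b then (0 : ℕ) else 1)) F = c a b + c b a := by
  classical
  have ht : ∀ a' b' : Fin 5,
      coeff (Finsupp.equivFunOnFinite.symm (fun z : Fin 5 => if z = a ∨ z = b then (0 : ℕ) else 1))
        (if a' = b' then (0 : MvPolynomial (Fin 5) ℂ) else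
          C (c a' b') * monomial (Finsupp.equivFunOnFinite.symm (fun z : Fin 5 => if z = a' ∨ z = b' then (0 : ℕ) else 1)) 1)
      = if a' = b' then 0 else (if (a' = a ∧ b' = b) ∨ (a' = b ∧ b' = a) then c a' b' else 0) := by
    intro a' b'
    rw [coeff_offDiag_summand]
    by_cases h : a' = b'
    · rw [if_pos h, if_pos h]
    · rw [if_neg h, if_neg h]
      by_cases hP : (a' = a ∧ b' = b) ∨ (a' = b ∧ b' = a)
      · rw [if_pos ((compl_exponent_eq_iff a b a' b' hab h).mpr hP), if_pos hP, mul_one]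
      · rw [if_neg (fun h' => hP ((compl_exponent_eq_iff a b a' b' hab h).mp h')), if_neg hP, mul_zero]
  rw [hF, coeff_sum]
  simp_rw [coeff_sum, ht]
  rw [Finset.sum_eq_add a b hab]
  · congr 1
    · rw [Finset.sum_eq_single b]
      · rw [if_neg hab, if_pos (Or.inl ⟨rfl, rfl⟩)]
      · intro b' _ hb'
        have hP : ¬((a = a ∧ b' = b) ∨ (a = b ∧ b' = a)) := by
          rintro (⟨_, h2⟩ | ⟨h2, _⟩)
          · exact hb' h2
          · exact hab h2
        rw [if_neg hP]
        split_ifs <;> rfl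
      · intro h; exact absurd (Finset.mem_univ b) h
    · rw [Finset.sum_eq_single a]
      · rw [if_neg (Ne.symm hab), if_pos (Or.inr ⟨rfl, rfl⟩)]
      · intro b' _ hb'
        have hP : ¬((b = a ∧ b' = b) ∨ (b = b ∧ b' = a)) := by
          rintro (⟨h2, _⟩ | ⟨_, h2⟩)
          · exact hab h2.symm
          · exact hb' h2
        rw [if_neg hP]
        split_ifs <;> rfl
      · intro h; exact absurd (Finset.mem_univ a) h
  · intro a' _ hne
    refine Finset.sum_eq_zero fun b' _ => ?_
    have hP : ¬((a' = a ∧ b' = b) ∨ (a' = b ∧ b' = a)) := by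
      rintro (⟨h2, _⟩ | ⟨h2, _⟩)
      · exact hne.1 h2
      · exact hne.2 h2
    rw [if_neg hP]
    split_ifs <;> rfl
  · intro h; exact absurd (Finset.mem_univ a) h
  · intro h; exact absurd (Finset.mem_univ b) h

/-- **A relation among the entries makes `L` divide the off-diagonal sum.** [folklore] -/
theorem linForm_dvd_offDiagSum (lam : Fin 5 → ℂ) (E : Fin 5 → Fin 5 → MvPolynomial (Fin 5) ℂ)
    (hE : ∀ a b : Fin 5, a ≠ b → (∑ z : Fin 5, lam z • (X z : MvPolynomial (Fin 5) ℂ)) ∣ E a b)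
    (c : Fin 5 → Fin 5 → ℂ)
    (hrel : ∑ a : Fin 5, ∑ b : Fin 5, (if a = b then 0 else
      C (c a b) * (monomial (Finsupp.equivFunOnFinite.symm (fun z : Fin 5 => if z = a ∨ z = b then (0 : ℕ) else 1)) 1 + E a b))
      = 0)
    (F : MvPolynomial (Fin 5) ℂ)
    (hF : F = ∑ a : Fin 5, ∑ b : Fin 5, (if a = b then 0 else
      C (c a b) * monomial (Finsupp.equivFunOnFinite.symm (fun z : Fin 5 => if z = a ∨ z = b then (0 : ℕ) else 1)) 1)) :
    (∑ z : Fin 5, lam z • (X z : MvPolynomial (Fin 5) ℂ)) ∣ F := by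
  have hsum : F + ∑ a : Fin 5, ∑ b : Fin 5, (if a = b then 0 else C (c a b) * E a b)
      = ∑ a : Fin 5, ∑ b : Fin 5, (if a = b then 0 else
        C (c a b) * (monomial (Finsupp.equivFunOnFinite.symm (fun z : Fin 5 => if z = a ∨ z = b then (0 : ℕ) else 1)) 1
          + E a b)) := by
    rw [hF, ← Finset.sum_add_distrib]
    refine Finset.sum_congr rfl fun a _ => ?_
    rw [← Finset.sum_add_distrib]
    refine Finset.sum_congr rfl fun b _ => ?_
    split_ifs with h
    · simp
    · ring
  have hsplit : F = -∑ a : Fin 5, ∑ b : Fin 5, (if a = b then 0 else C (c a b) * E a b) := by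
    rw [eq_neg_iff_add_eq_zero, hsum, hrel]
  rw [hsplit]
  refine (Finset.dvd_sum fun a _ => Finset.dvd_sum fun b _ => ?_).neg_right
  split_ifs with h
  · exact dvd_zero _
  · exact Dvd.dvd.mul_left (hE a b h) _

/-- **Off-diagonal entries independent for `|supp λ| ≥ 4`.**  If at most one `λ_z` vanishes, `E_{ab}` (`a ≠ b`) are divisible by
`L = Σ λ_z X_z`, and `Σ_{a ≠ b} c_{ab}·(x^{{a,b}ᶜ} + E_{ab}) = 0`, then `c_{ab} + c_{ba} = 0` for all `a ≠ b`. [folklore] -/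
theorem offDiag_entries_independent (lam : Fin 5 → ℂ) (hbig : ∀ i j : Fin 5, i ≠ j → lam i ≠ 0 ∨ lam j ≠ 0)
    (E : Fin 5 → Fin 5 → MvPolynomial (Fin 5) ℂ)
    (hE : ∀ a b : Fin 5, a ≠ b → (∑ z : Fin 5, lam z • (X z : MvPolynomial (Fin 5) ℂ)) ∣ E a b)
    (c : Fin 5 → Fin 5 → ℂ)
    (hrel : ∑ a : Fin 5, ∑ b : Fin 5, (if a = b then 0 else
      C (c a b) * (monomial (Finsupp.equivFunOnFinite.symm (fun z : Fin 5 => if z = a ∨ z = b then (0 : ℕ) else 1)) 1 + E a b))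
      = 0)
    (a b : Fin 5) (hab : a ≠ b) : c a b + c b a = 0 := by
  classical
  set L : MvPolynomial (Fin 5) ℂ := ∑ z : Fin 5, lam z • (X z : MvPolynomial (Fin 5) ℂ) with hL
  set F : MvPolynomial (Fin 5) ℂ := ∑ a : Fin 5, ∑ b : Fin 5, (if a = b then 0 else
      C (c a b) * monomial (Finsupp.equivFunOnFinite.symm (fun z : Fin 5 => if z = a ∨ z = b then (0 : ℕ) else 1)) 1) with hF
  obtain ⟨G, hG⟩ := linForm_dvd_offDiagSum lam E hE c hrel F hF
  obtain ⟨z₀, hz₀⟩ : ∃ z₀ : Fin 5, lam z₀ ≠ 0 := by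
    rcases hbig 0 1 (by decide) with h0 | h1
    · exact ⟨0, h0⟩
    · exact ⟨1, h1⟩
  have hL1 : L.IsHomogeneous 1 := Literature.RingTheory.MvPolynomial.isHomogeneous_one_sum_smul_X lam
  have hL0 : L ≠ 0 := by
    intro h0
    have := (Literature.RingTheory.MvPolynomial.sum_smul_X_eq_zero_iff lam).mp h0
    exact hz₀ (by rw [this]; rfl)
  have hGh : G.IsHomogeneous 2 :=
    isHomogeneous_of_mul_eq (d := 2) (m := 1) (n := 3) hL1 hL0 (offDiagSum_isHomogeneous c F hF) (by rw [hG]; ring) rfl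
  have hF0 : F = 0 := squarefree_dvd_linForm_eq_zero lam hbig F G hGh (coeff_offDiagSum_cube c F hF)
    (fun i j _ => coeff_offDiagSum_sq c F hF i j) hG
  have hc := coeff_offDiagSum_compl c F hF a b hab
  rw [hF0, coeff_zero] at hc
  exact hc.symm

end LaplaceFiveStar

end Summit.ValiantsHypothesis.ValiantsHypothesis.Theorems.RigidityForcesSymmetryRankRigidMinimalRepr
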